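import Literature.Geometry.Symplectic.SteinDomain
import Literature.Geometry.Symplectic.SteinJBundle
import Literature.Geometry.Symplectic.SteinLiouville
import Literature.Geometry.Kaehler.ManifoldFormsPullback
import Literature.Topology.FourManifolds.RegularDomainMaps
import HarnessLib

/-!
# Regular domains of a `4`-manifold with boundary: vector fields, `J` and integrability within a set

Topic `Literature/Geometry/Symplectic`; infrastructure of the fact seat of
`Literature.Geometry.Symplectic.Gompf1998_thm13_twoHandles` (**E2**, `SteinTwoHandles.lean`),
step "shrinking, analytic half": the Stein structure of `W` restricts to a Stein structure on a
high sublevel set `{φ ≤ c}` (a *regular domain* of `W` in the sense of `RegularSublevelSet.lean`: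
a subset carrying a half-slice atlas `Literature.Topology.FourManifolds.HalfSliceAtlas`).  This
file contains the part of that restriction which is not specific to Stein structures — the
differential calculus of a regular domain `t ⊆ W` of a `4`-manifold with boundary read in the
ambient manifold, for an arbitrary smooth field of endomorphisms `J` — and its main result is
the **integrability of the restricted almost complex structure** (`nijenhuis_domJ_eq_zero`).
Everything is **proved**; the definitions are auxiliary (no named facts).

The pattern is that of `SteinOneHandlebodies.lean` §3–4 (regular sublevel sets of `ℝ⁴` with a
*constant* `J₀`), with two differences: the ambient manifold is an abstract `W` (so vector
fields of `t` are read in `TW` through the differential of the inclusion and a retraction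
`W → t` smooth within `t`, instead of through a global trivialisation), and `J` is variable, so
that the vanishing of the Nijenhuis expression *within* `t` is no longer an algebraic identity
but requires the tensoriality of the Nijenhuis tensor (§3).

## Contents

* §1 `RegularDomain.*` for `Φ : HalfSliceAtlas (𝓡∂ 4) t` (the manifold structure
  `Φ.chartedSpace` entering through an instance argument `cs` with `hcs : cs = Φ.chartedSpace`):
  the differential `valDeriv p : ℝ⁴ ≃L ℝ⁴` of the inclusion `ι : t → W` is invertible
  (`isInvertible_mfderiv_val`); Mathlib's pull-back along `ι` is `(Dι)⁻¹` (`mpullback_val`);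
  the retraction `retr` is `C^∞` within `t` (`contMDiffWithinAt_retr`); the ambient
  representative `extVF X = Dι X` of a smooth vector field of `t` is `C^∞` within `t` as a map
  into `TW` (`contMDiffWithinAt_extVF`), and conversely (`contMDiffAt_mpullback_val`, Mathlib's
  `ContMDiffWithinAt.mpullback_vectorField_preimage`); Lie brackets of `t` are `(Dι)⁻¹` of
  ambient Lie brackets within `t` (`mlieBracket_eq_valDeriv_symm_mlieBracketWithin`, Mathlib's
  `VectorField.mpullback_mlieBracketWithin`).
* §2 `ContMDiffWithinAt.J_family` — a field of endomorphisms preserving smooth vector fields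
  (`PreservesSmoothFields`, `SteinJBundle.lean`) acts on families of tangent vectors `C^∞`
  within a set (through the smooth matrix `JTriv` of `J` in a trivialization); the Nijenhuis
  expression `nijenhuisWithin J V W s x` with Lie brackets within `s` (`= nijenhuis` for
  `s = univ`), written with `JT`/`applyJ` so that all operations live in the tangent spaces.
* §3 **Tensoriality**: `nijenhuisWithin` is local, antisymmetric, additive and `C^∞(W)`-linear
  in each slot (`nijenhuisWithin_smul_left`: the `df`-terms cancel in pairs using `J² = -1`),
  and agrees with `nijenhuis` on fields differentiable at the point; whence
  **`nijenhuisWithin_eq_zero`**: if `N_J = 0` on smooth vector fields of `W`, then `N_J`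
  computed within a set of unique differentiability vanishes on fields merely `C^∞` within the
  set at the point (expand in the frame of constant sections of the trivialization, globalised
  by a smooth bump function).
* §4 `RegularDomain.domJ = (Dι)⁻¹ ∘ J ∘ Dι` on `t`: `(domJ)² = -1`, it preserves smooth vector
  fields (`isSmoothVectorField_domJ`), its Nijenhuis tensor is `(Dι)⁻¹` of `nijenhuisWithin`
  on the ambient representatives (`nijenhuis_domJ`), `t` has unique differentiability at its
  points (`uniqueMDiffWithinAt`), and **`nijenhuis_domJ_eq_zero`**.

## References

* K. Cieliebak, Ya. Eliashberg, *From Stein to Weinstein and Back*, AMS Colloquium Publ. 59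
  (2012), §1 (integrable `J`, the Nijenhuis tensor), Def. 1.1 ff. (Stein domains as sublevel
  sets). [CieliebakEliashberg2012]
* A. Newlander, L. Nirenberg, *Complex analytic coordinates in almost complex manifolds*, Ann.
  of Math. 65 (1957), 391–404 (the tensor `N_J`). [NewlanderNirenberg1957]
* J. M. Lee, *Introduction to Smooth Manifolds*, 2nd ed. (2013), Prop. 5.47, Cor. 5.30
  (regular domains, maps into them). [LeeSmoothManifolds2013]
-/

noncomputable section

open scoped Manifold ContDiff Topology
open Set Function Filter VectorField Bundle

namespace Literature.Geometry.Symplectic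

open Literature.Topology.FourManifolds

/-! ### §1 Regular domains of a `4`-manifold with boundary: the inclusion and its differential -/

namespace RegularDomain

section Retr

variable {W : Type*} {t : Set W}

/-- The retraction `W → t` used to read functions on `t` ambiently: the identity on `t`, the
junk value `p₀` elsewhere. [folklore] -/
def retr (p₀ : t) (y : W) : t := by
  classical
  exact if h : y ∈ t then ⟨y, h⟩ else p₀

/-- On `t` the retraction is the identity. [folklore] -/
theorem retr_of_mem (p₀ : t) {y : W} (hy : y ∈ t) : retr p₀ y = ⟨y, hy⟩ := by
  classical
  exact dif_pos hy

/-- On `t` the retraction is the identity. [folklore] -/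
@[simp] theorem retr_val (p₀ q : t) : retr p₀ q.1 = q := by
  rw [retr_of_mem p₀ q.2]

end Retr

variable {W : Type*} [TopologicalSpace W] [ChartedSpace (EuclideanHalfSpace 4) W]
  {t : Set W} (Φ : HalfSliceAtlas (𝓡∂ 4) t)
  [cs : ChartedSpace (EuclideanHalfSpace 4) t] (hcs : cs = Φ.chartedSpace)

omit cs in
/-- `Θₚ` is smooth at points of its source. [folklore] -/
theorem contMDiffAt_Θ {p : t} {y : W} (hy : y ∈ (Φ.datum p).Θ.source) :
    ContMDiffAt (𝓡∂ 4) 𝓘(ℝ, EuclideanSpace ℝ (Fin 4)) ∞ (Φ.datum p).Θ y :=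
  (Φ.datum p).contMDiffOn_toFun.contMDiffAt ((Φ.datum p).Θ.open_source.mem_nhds hy)

omit cs in
/-- `Θₚ⁻¹` is smooth at points of its target. [folklore] -/
theorem contMDiffAt_Θ_symm {p : t} {z : EuclideanSpace ℝ (Fin 4)} (hz : z ∈ (Φ.datum p).Θ.target) :
    ContMDiffAt 𝓘(ℝ, EuclideanSpace ℝ (Fin 4)) (𝓡∂ 4) ∞ (Φ.datum p).Θ.symm z :=
  (Φ.datum p).contMDiffOn_symm.contMDiffAt ((Φ.datum p).Θ.open_target.mem_nhds hz)

include hcs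

/-- With the structure of a half-slice atlas, a regular domain is a `C^∞` manifold with
boundary. [folklore] -/
theorem isManifold : IsManifold (𝓡∂ 4) ∞ t := by
  subst hcs; exact Φ.isManifold

omit cs hcs in
/-- Points of `t` lie in the source of their half-slice chart. [folklore] -/
theorem mem_source (p : t) : p.1 ∈ (Φ.datum p).Θ.source :=
  Φ.mem_source p

/-- The extended chart of the domain at `p` is the half-slice chart `Θₚ` composed with the
inclusion, on the chart source. [folklore] -/
theorem extChartAt_apply {p q : t} (hq : q.1 ∈ (Φ.datum p).Θ.source) :
    extChartAt (𝓡∂ 4) p q = (Φ.datum p).Θ q.1 := by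
  subst hcs
  exact (Φ.datum p).extend_chart_apply (show q ∈ ((Φ.datum p).chart p).source from hq)

/-- The chart source of the domain at `p` is the preimage of the source of `Θₚ`. [folklore] -/
theorem chartAt_source (p : t) :
    (chartAt (EuclideanHalfSpace 4) p).source = Subtype.val ⁻¹' (Φ.datum p).Θ.source := by
  subst hcs; rfl

/-- **The differential of the inclusion of a regular domain is invertible.**  Near `p` the
inclusion is `Θₚ⁻¹ ∘ (extended chart at p)`; the extended chart has the identity as
differential at `p`, and `d(Θₚ⁻¹)` is invertible with inverse `dΘₚ`. [folklore] -/
theorem isInvertible_mfderiv_val (p : t) :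
    (mfderiv (𝓡∂ 4) (𝓡∂ 4) (Subtype.val : t → W) p).IsInvertible := by
  haveI := isManifold Φ hcs
  set D := Φ.datum p with hD
  have hps : p.1 ∈ D.Θ.source := mem_source Φ p
  have hz : D.Θ p.1 ∈ D.Θ.target := D.Θ.map_source hps
  have hΘ : MDifferentiableAt (𝓡∂ 4) 𝓘(ℝ, EuclideanSpace ℝ (Fin 4)) D.Θ p.1 :=
    (contMDiffAt_Θ Φ hps).mdifferentiableAt (by simp)
  have hΘs : MDifferentiableAt 𝓘(ℝ, EuclideanSpace ℝ (Fin 4)) (𝓡∂ 4) D.Θ.symm (D.Θ p.1) :=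
    (contMDiffAt_Θ_symm Φ hz).mdifferentiableAt (by simp)
  -- `d(Θ⁻¹) ∘ dΘ = id` and `dΘ ∘ d(Θ⁻¹) = id`
  set A := mfderiv 𝓘(ℝ, EuclideanSpace ℝ (Fin 4)) (𝓡∂ 4) D.Θ.symm (D.Θ p.1) with hA
  set B := mfderiv (𝓡∂ 4) 𝓘(ℝ, EuclideanSpace ℝ (Fin 4)) D.Θ p.1 with hB
  have hAB : ∀ v, A (B v) = v := by
    have hev : (D.Θ.symm ∘ D.Θ) =ᶠ[𝓝 p.1] id := D.Θ.eventually_left_inverse hps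
    have h1 : mfderiv (𝓡∂ 4) (𝓡∂ 4) (D.Θ.symm ∘ D.Θ) p.1 = ContinuousLinearMap.id ℝ _ := by
      rw [hev.mfderiv_eq]; exact mfderiv_id
    have h2 : mfderiv (𝓡∂ 4) (𝓡∂ 4) (D.Θ.symm ∘ D.Θ) p.1 = A.comp B :=
      mfderiv_comp_of_eq hΘs hΘ rfl
    intro v
    have := ContinuousLinearMap.ext_iff.1 (h2.symm.trans h1) v
    exact this
  have hBA : ∀ z, B (A z) = z := by
    have hev : (D.Θ ∘ D.Θ.symm) =ᶠ[𝓝 (D.Θ p.1)] id := D.Θ.eventually_right_inverse' hps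
    have hΘ' : MDifferentiableAt (𝓡∂ 4) 𝓘(ℝ, EuclideanSpace ℝ (Fin 4)) D.Θ
        (D.Θ.symm (D.Θ p.1)) := by
      rw [D.Θ.left_inv hps]; exact hΘ
    have h1 : mfderiv 𝓘(ℝ, EuclideanSpace ℝ (Fin 4)) 𝓘(ℝ, EuclideanSpace ℝ (Fin 4))
        (D.Θ ∘ D.Θ.symm) (D.Θ p.1) = ContinuousLinearMap.id ℝ _ := by
      rw [hev.mfderiv_eq]; exact mfderiv_id
    have h2 : mfderiv 𝓘(ℝ, EuclideanSpace ℝ (Fin 4)) 𝓘(ℝ, EuclideanSpace ℝ (Fin 4))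
        (D.Θ ∘ D.Θ.symm) (D.Θ p.1) = (mfderiv (𝓡∂ 4) 𝓘(ℝ, EuclideanSpace ℝ (Fin 4)) D.Θ
          (D.Θ.symm (D.Θ p.1))).comp A :=
      mfderiv_comp_of_eq hΘ' hΘs rfl
    rw [D.Θ.left_inv hps] at h2
    intro z
    have := ContinuousLinearMap.ext_iff.1 (h2.symm.trans h1) z
    exact this
  -- `val = Θ⁻¹ ∘ extChartAt p` near `p`, whose differential at `p` is `A`
  have hsrc : (chartAt (EuclideanHalfSpace 4) p).source ∈ 𝓝 p := chart_source_mem_nhds _ p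
  have heq : (Subtype.val : t → W) =ᶠ[𝓝 p] D.Θ.symm ∘ extChartAt (𝓡∂ 4) p := by
    filter_upwards [hsrc] with q hq
    rw [chartAt_source Φ hcs] at hq
    rw [comp_apply, extChartAt_apply Φ hcs hq, D.Θ.left_inv hq]
  have hext := hasMFDerivAt_extChartAt (I := 𝓡∂ 4) (mem_chart_source (EuclideanHalfSpace 4) p)
  have hpp : extChartAt (𝓡∂ 4) p p = D.Θ p.1 := extChartAt_apply Φ hcs hps
  have hΘs' : HasMFDerivAt 𝓘(ℝ, EuclideanSpace ℝ (Fin 4)) (𝓡∂ 4) D.Θ.symm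
      (extChartAt (𝓡∂ 4) p p) A := by
    rw [hpp]; exact hΘs.hasMFDerivAt
  have hval := (hΘs'.comp p hext).congr_of_eventuallyEq heq
  have hvalv : ∀ v : EuclideanSpace ℝ (Fin 4),
      mfderiv (𝓡∂ 4) (𝓡∂ 4) (Subtype.val : t → W) p v = A v := fun v => by
    rw [hval.mfderiv]
    show A (mfderiv (𝓡∂ 4) (𝓡∂ 4) (chartAt (EuclideanHalfSpace 4) p) p v) = A v
    rw [mfderiv_chartAt_eq_tangentCoordChange (mem_chart_source _ p)]
    congr 1
    show (tangentCoordChange (𝓡∂ 4) p p p v : EuclideanSpace ℝ (Fin 4)) = v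
    exact tangentCoordChange_self (mem_extChartAt_source p)
  have h1 : Function.LeftInverse (B : EuclideanSpace ℝ (Fin 4) → EuclideanSpace ℝ (Fin 4))
      (mfderiv (𝓡∂ 4) (𝓡∂ 4) (Subtype.val : t → W) p) := fun v => by
    show B (mfderiv (𝓡∂ 4) (𝓡∂ 4) (Subtype.val : t → W) p v) = v
    rw [hvalv]; exact hBA v
  have h2 : Function.RightInverse (B : EuclideanSpace ℝ (Fin 4) → EuclideanSpace ℝ (Fin 4))
      (mfderiv (𝓡∂ 4) (𝓡∂ 4) (Subtype.val : t → W) p) := fun v => by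
    show mfderiv (𝓡∂ 4) (𝓡∂ 4) (Subtype.val : t → W) p (B v) = v
    rw [hvalv]; exact hAB v
  exact ⟨ContinuousLinearEquiv.equivOfInverse (mfderiv (𝓡∂ 4) (𝓡∂ 4) (Subtype.val : t → W) p)
    (B : EuclideanSpace ℝ (Fin 4) →L[ℝ] EuclideanSpace ℝ (Fin 4)) h1 h2, rfl⟩

/-- **The differential of the inclusion as a linear isomorphism** `Dι_p : T_p t ≃ T_{p} W` (both
read in the preferred charts, i.e. as `ℝ⁴`). [folklore] -/
def valDeriv (p : t) : EuclideanSpace ℝ (Fin 4) ≃L[ℝ] EuclideanSpace ℝ (Fin 4) :=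
  (isInvertible_mfderiv_val Φ hcs p).choose

/-- `valDeriv` is the manifold derivative of the inclusion. [folklore] -/
theorem coe_valDeriv (p : t) :
    (valDeriv Φ hcs p : EuclideanSpace ℝ (Fin 4) →L[ℝ] EuclideanSpace ℝ (Fin 4)) =
      mfderiv (𝓡∂ 4) (𝓡∂ 4) (Subtype.val : t → W) p :=
  (isInvertible_mfderiv_val Φ hcs p).choose_spec

/-- `valDeriv`, applied. [folklore] -/
theorem valDeriv_apply (p : t) (v : EuclideanSpace ℝ (Fin 4)) :
    valDeriv Φ hcs p v = mfderiv (𝓡∂ 4) (𝓡∂ 4) (Subtype.val : t → W) p v := by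
  rw [← coe_valDeriv Φ hcs p]; rfl

/-- The inverse of the differential of the inclusion. [folklore] -/
theorem inverse_mfderiv_val (p : t) :
    (mfderiv (𝓡∂ 4) (𝓡∂ 4) (Subtype.val : t → W) p).inverse =
      ((valDeriv Φ hcs p).symm : EuclideanSpace ℝ (Fin 4) →L[ℝ] EuclideanSpace ℝ (Fin 4)) := by
  rw [← coe_valDeriv Φ hcs p]
  exact ContinuousLinearMap.inverse_equiv (valDeriv Φ hcs p)

/-- **Mathlib's pull-back of an ambient vector field along the inclusion** is
`p ↦ (Dι_p)⁻¹ (V p)`. [folklore] -/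
theorem mpullback_val (V : (y : W) → TangentSpace (𝓡∂ 4) y) (p : t) :
    mpullback (𝓡∂ 4) (𝓡∂ 4) (Subtype.val : t → W) V p = (valDeriv Φ hcs p).symm (V p.1) := by
  rw [mpullback_apply, inverse_mfderiv_val Φ hcs p]
  rfl

/-! #### The retraction within `t` and the ambient representative of a vector field -/

/-- **The retraction is smooth within `t`** at every point of `t` (in the chart of `t` at `p`
it reads as the half-slice chart `Θₚ`). [folklore] -/
theorem contMDiffWithinAt_retr (p₀ p : t) :
    ContMDiffWithinAt (𝓡∂ 4) (𝓡∂ 4) ∞ (retr p₀ : W → t) t p.1 := by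
  haveI := isManifold Φ hcs
  have hps : p.1 ∈ (Φ.datum p).Θ.source := mem_source Φ p
  rw [contMDiffWithinAt_iff_target]
  constructor
  · have h : ContinuousWithinAt (Subtype.val ∘ (retr p₀ : W → t)) t p.1 :=
      continuousWithinAt_id.congr (fun y hy => by rw [comp_apply, retr_of_mem p₀ hy]; rfl)
        (by rw [comp_apply, retr_val]; rfl)
    exact Topology.IsInducing.subtypeVal.continuousWithinAt_iff.2 h
  · rw [retr_val]
    refine (contMDiffAt_Θ Φ hps).contMDiffWithinAt.congr_of_eventuallyEq ?_ ?_
    · filter_upwards [self_mem_nhdsWithin,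
        mem_nhdsWithin_of_mem_nhds ((Φ.datum p).Θ.open_source.mem_nhds hps)] with y hy hys
      rw [comp_apply, retr_of_mem p₀ hy]
      exact extChartAt_apply Φ hcs (q := ⟨y, hy⟩) hys
    · rw [comp_apply, retr_val]
      exact extChartAt_apply Φ hcs hps

/-- **The ambient representative of a vector field `X` of the domain**: `Dι (X)` on `t`,
zero elsewhere. [folklore] -/
def extVF (X : (q : t) → TangentSpace (𝓡∂ 4) q) (y : W) : TangentSpace (𝓡∂ 4) y := by
  classical
  exact if h : y ∈ t then valDeriv Φ hcs ⟨y, h⟩ (X ⟨y, h⟩) else 0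

/-- On `t` the ambient representative is `Dι X`. [folklore] -/
theorem extVF_of_mem (X : (q : t) → TangentSpace (𝓡∂ 4) q) {y : W} (hy : y ∈ t) :
    extVF Φ hcs X y = valDeriv Φ hcs ⟨y, hy⟩ (X ⟨y, hy⟩) := by
  classical
  exact dif_pos hy

/-- On `t` the ambient representative is `Dι X`. [folklore] -/
@[simp] theorem extVF_val (X : (q : t) → TangentSpace (𝓡∂ 4) q) (q : t) :
    extVF Φ hcs X q.1 = valDeriv Φ hcs q (X q) := by
  rw [extVF_of_mem Φ hcs X q.2]

/-- Off `t` the ambient representative vanishes. [folklore] -/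
theorem extVF_of_not_mem (X : (q : t) → TangentSpace (𝓡∂ 4) q) {y : W} (hy : y ∉ t) :
    extVF Φ hcs X y = 0 := by
  classical
  exact dif_neg hy

/-- Pulling the ambient representative back along the inclusion returns the field. [folklore] -/
@[simp] theorem mpullback_val_extVF (X : (q : t) → TangentSpace (𝓡∂ 4) q) :
    mpullback (𝓡∂ 4) (𝓡∂ 4) (Subtype.val : t → W) (extVF Φ hcs X) = X := by
  funext q
  rw [mpullback_val Φ hcs, extVF_val, ContinuousLinearEquiv.symm_apply_apply]

variable [IsManifold (𝓡∂ 4) ∞ W] [IsManifold (𝓡∂ 4) ∞ t]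

/-- The inclusion of a regular domain is smooth. [folklore] -/
theorem contMDiff_val : ContMDiff (𝓡∂ 4) (𝓡∂ 4) ∞ (Subtype.val : t → W) := by
  subst hcs; exact Φ.contMDiff_subtype_val (k := 3) (by norm_num)

/-- **A smooth vector field of the domain has an ambient representative smooth within `t`**
(as a map into `TW`: it is `Tι ∘ X ∘ retr` on `t`). [folklore] -/
theorem contMDiffWithinAt_extVF {X : (q : t) → TangentSpace (𝓡∂ 4) q} {p : t}
    (hX : ContMDiffAt (𝓡∂ 4) (𝓡∂ 4).tangent ∞ (T% X) p) :
    ContMDiffWithinAt (𝓡∂ 4) (𝓡∂ 4).tangent ∞ (T% (extVF Φ hcs X)) t p.1 := by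
  have h1 : ContMDiffAt (𝓡∂ 4) (𝓡∂ 4).tangent ∞
      (fun q : t => tangentMap (𝓡∂ 4) (𝓡∂ 4) (Subtype.val : t → W) (T% X q)) p :=
    ((contMDiff_val Φ hcs).contMDiff_tangentMap le_rfl).contMDiffAt.comp p hX
  have h2 := h1.comp_contMDiffWithinAt_of_eq (contMDiffWithinAt_retr Φ hcs p p) (retr_val p p)
  refine h2.congr_of_eventuallyEq ?_ ?_
  · filter_upwards [self_mem_nhdsWithin] with y hy
    rw [comp_apply, retr_of_mem p hy]
    show (TotalSpace.mk' _ y (extVF Φ hcs X y) : TangentBundle (𝓡∂ 4) W) = _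
    rw [extVF_of_mem Φ hcs X hy, valDeriv_apply]
    rfl
  · rw [comp_apply, retr_val]
    show (TotalSpace.mk' _ p.1 (extVF Φ hcs X p.1) : TangentBundle (𝓡∂ 4) W) = _
    rw [extVF_val, valDeriv_apply]
    rfl

/-- **Conversely, pulling back along the inclusion an ambient vector field smooth within `t`
gives a smooth vector field of the domain** (Mathlib's
`ContMDiffWithinAt.mpullback_vectorField_preimage`). [folklore] -/
theorem contMDiffAt_mpullback_val {V : (y : W) → TangentSpace (𝓡∂ 4) y} {p : t}
    (hV : ContMDiffWithinAt (𝓡∂ 4) (𝓡∂ 4).tangent ∞ (T% V) t p.1) :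
    ContMDiffAt (𝓡∂ 4) (𝓡∂ 4).tangent ∞
      (T% (mpullback (𝓡∂ 4) (𝓡∂ 4) (Subtype.val : t → W) V)) p := by
  have key := hV.mpullback_vectorField_preimage ((contMDiff_val Φ hcs) p)
    (isInvertible_mfderiv_val Φ hcs p) le_rfl
  have huniv : (Subtype.val : t → W) ⁻¹' t = univ := eq_univ_of_forall fun q => q.2
  rwa [huniv, contMDiffWithinAt_univ] at key

/-- **Lie brackets of the domain are ambient Lie brackets within `t`**: for smooth vector fields
`X`, `Y` of `t`, `[X, Y](p) = (Dι_p)⁻¹ [X̃, Ỹ]_t (p)` with `X̃`, `Ỹ` the ambient representatives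
(Mathlib's `VectorField.mpullback_mlieBracketWithin` along the inclusion). [folklore] -/
theorem mlieBracket_eq_valDeriv_symm_mlieBracketWithin
    {X Y : (q : t) → TangentSpace (𝓡∂ 4) q}
    (hX : IsSmoothVectorField t X) (hY : IsSmoothVectorField t Y) (p : t) :
    mlieBracket (𝓡∂ 4) X Y p = (valDeriv Φ hcs p).symm
      (mlieBracketWithin (𝓡∂ 4) (extVF Φ hcs X) (extVF Φ hcs Y) t p.1) := by
  haveI : IsManifold (𝓡∂ 4) (minSmoothness ℝ 2) t := by
    rw [minSmoothness_of_isRCLikeNormedField]; infer_instance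
  haveI : IsManifold (𝓡∂ 4) (minSmoothness ℝ 2) W := by
    rw [minSmoothness_of_isRCLikeNormedField]; infer_instance
  have hVX : MDifferentiableWithinAt (𝓡∂ 4) (𝓡∂ 4).tangent (T% (extVF Φ hcs X)) t p.1 :=
    (contMDiffWithinAt_extVF Φ hcs (hX p)).mdifferentiableWithinAt (by simp)
  have hVY : MDifferentiableWithinAt (𝓡∂ 4) (𝓡∂ 4).tangent (T% (extVF Φ hcs Y)) t p.1 :=
    (contMDiffWithinAt_extVF Φ hcs (hY p)).mdifferentiableWithinAt (by simp)
  have key := mpullback_mlieBracketWithin (I := 𝓡∂ 4) (I' := 𝓡∂ 4)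
    (f := (Subtype.val : t → W)) (V := extVF Φ hcs X) (W := extVF Φ hcs Y) (x₀ := p)
    (s := univ) (t := t) (n := ∞) hVX hVY uniqueMDiffOn_univ ((contMDiff_val Φ hcs) p)
    (mem_univ _) (by rw [minSmoothness_of_isRCLikeNormedField]; exact ENat.LEInfty.out)
    (univ_mem' fun q => q.2)
  rw [mpullback_val_extVF, mpullback_val_extVF, mlieBracketWithin_univ] at key
  rw [← key, mpullback_val Φ hcs]

end RegularDomain

/-! ### §2 `J` along families of tangent vectors smooth within a set; the Nijenhuis tensor within a set -/

section JWithin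

variable {W : Type*} [TopologicalSpace W] [T2Space W] [ChartedSpace (EuclideanHalfSpace 4) W]
  [IsManifold (𝓡∂ 4) ∞ W]

/-- **Smoothness of `J` along families of tangent vectors smooth within a set.**  If
`q ↦ (x q, v q) ∈ TW` is `C^∞` within `s` at `q₀` (as a map into the tangent bundle), so is
`q ↦ (x q, J_{x q} (v q))`: in the trivialization at `x q₀` the fibre coordinate of the latter is
`∑ᵢ (e (x q, v q))ᵢ • JTriv J (x q₀) (x q) eᵢ`, a combination of functions smooth within `s`
(`contMDiffAt_JTriv`). [folklore] -/
theorem ContMDiffWithinAt.J_family {J : (x : W) → (EuclideanSpace ℝ (Fin 4) →L[ℝ]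
      EuclideanSpace ℝ (Fin 4))} (hJ : PreservesSmoothFields J)
    {P : Type*} [TopologicalSpace P] {HP : Type*} [TopologicalSpace HP] {EP : Type*}
    [NormedAddCommGroup EP] [NormedSpace ℝ EP] {IP : ModelWithCorners ℝ EP HP} [ChartedSpace HP P]
    {x : P → W} {v : P → EuclideanSpace ℝ (Fin 4)} {s : Set P} {q₀ : P}
    (h : ContMDiffWithinAt IP (𝓡∂ 4).tangent ∞
      (fun q => (TotalSpace.mk' (EuclideanSpace ℝ (Fin 4)) (x q) (v q) : TangentBundle (𝓡∂ 4) W))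
      s q₀) :
    ContMDiffWithinAt IP (𝓡∂ 4).tangent ∞
      (fun q => (TotalSpace.mk' (EuclideanSpace ℝ (Fin 4)) (x q) (J (x q) (v q)) :
        TangentBundle (𝓡∂ 4) W)) s q₀ := by
  set x₀ := x q₀ with hx₀
  set e := trivializationAt (EuclideanSpace ℝ (Fin 4)) (TangentSpace (𝓡∂ 4)) x₀ with he
  rw [show (𝓡∂ 4).tangent = (𝓡∂ 4).prod 𝓘(ℝ, EuclideanSpace ℝ (Fin 4)) from rfl,
    contMDiffWithinAt_totalSpace] at h ⊢
  obtain ⟨hx, hv⟩ := h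
  refine ⟨hx, ?_⟩
  -- `x q` stays in the chart domain of `x₀` near `q₀` within `s`
  have hsrc : ∀ᶠ q in 𝓝[s] q₀, x q ∈ (chartAt (EuclideanHalfSpace 4) x₀).source :=
    hx.continuousWithinAt.preimage_mem_nhdsWithin
      ((chartAt _ x₀).open_source.mem_nhds (mem_chart_source _ x₀))
  -- the formula for the fibre coordinate of `J v`
  have hform : ∀ q, x q ∈ (chartAt (EuclideanHalfSpace 4) x₀).source →
      (e (⟨x q, J (x q) (v q)⟩ : TangentBundle (𝓡∂ 4) W)).2 =
        ∑ i, (e (⟨x q, v q⟩ : TangentBundle (𝓡∂ 4) W)).2 i •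
          JTriv J x₀ (x q) (EuclideanSpace.single i (1 : ℝ)) := by
    intro q hq
    rw [he, trivializationAt_J_apply J hq (v q)]
    conv_lhs => rw [← sum_apply_smul_single
      ((trivializationAt (EuclideanSpace ℝ (Fin 4)) (TangentSpace (𝓡∂ 4)) x₀)
        (⟨x q, v q⟩ : TangentBundle (𝓡∂ 4) W)).2]
    simp only [map_sum, map_smul]
  have hterm : ∀ i, ContMDiffWithinAt IP 𝓘(ℝ, EuclideanSpace ℝ (Fin 4)) ∞
      (fun q => (e (⟨x q, v q⟩ : TangentBundle (𝓡∂ 4) W)).2 i •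
        JTriv J x₀ (x q) (EuclideanSpace.single i (1 : ℝ))) s q₀ := fun i => by
    have h1 : ContMDiffWithinAt IP 𝓘(ℝ, ℝ) ∞
        (fun q => (e (⟨x q, v q⟩ : TangentBundle (𝓡∂ 4) W)).2 i) s q₀ :=
      ((EuclideanSpace.proj i).contDiff.comp_contMDiffWithinAt hv)
    have h2 : ContMDiffWithinAt IP 𝓘(ℝ, EuclideanSpace ℝ (Fin 4)) ∞
        (fun q => JTriv J x₀ (x q) (EuclideanSpace.single i (1 : ℝ))) s q₀ :=
      (contMDiffAt_JTriv hJ x₀ _ (mem_chart_source _ x₀)).comp_contMDiffWithinAt q₀ hx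
    exact h1.smul h2
  refine (contMDiffWithinAt_finsetSum (t := Finset.univ) fun i _ => hterm i).congr_of_eventuallyEq
    ?_ ?_
  · filter_upwards [hsrc] with q hq
    exact hform q hq
  · exact hform q₀ (mem_chart_source _ x₀)

/-- `J_x` as a map of the tangent space `T_xW` (a type synonym of `ℝ⁴`) to itself — so that
sums, scalar multiples and negations of its values are taken in `T_xW`, as in Mathlib's
Lie-bracket identities. [folklore] -/
def JT (J : (x : W) → (EuclideanSpace ℝ (Fin 4) →L[ℝ] EuclideanSpace ℝ (Fin 4))) (x : W)
    (b : TangentSpace (𝓡∂ 4) x) : TangentSpace (𝓡∂ 4) x :=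
  J x b

omit [T2Space W] [IsManifold (𝓡∂ 4) ∞ W] in
/-- Unfolding `JT`. [folklore] -/
theorem JT_eq (J : (x : W) → (EuclideanSpace ℝ (Fin 4) →L[ℝ] EuclideanSpace ℝ (Fin 4))) (x : W)
    (b : TangentSpace (𝓡∂ 4) x) : JT J x b = J x b := rfl

/-- The vector field `x ↦ J_x (V x)` (a named section, so that Mathlib's `T%` elaborator sees a
section of `TW`). [folklore] -/
def applyJ (J : (x : W) → (EuclideanSpace ℝ (Fin 4) →L[ℝ] EuclideanSpace ℝ (Fin 4)))
    (V : (x : W) → TangentSpace (𝓡∂ 4) x) : (x : W) → TangentSpace (𝓡∂ 4) x :=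
  fun x => JT J x (V x)

omit [T2Space W] [IsManifold (𝓡∂ 4) ∞ W] in
/-- Unfolding `applyJ`. [folklore] -/
@[simp] theorem applyJ_apply (J : (x : W) → (EuclideanSpace ℝ (Fin 4) →L[ℝ]
      EuclideanSpace ℝ (Fin 4))) (V : (x : W) → TangentSpace (𝓡∂ 4) x) (x : W) :
    applyJ J V x = JT J x (V x) := rfl

/-- **The Nijenhuis expression within a set**: `N_J(V, W)` computed with Lie brackets within
`s` — `[JV, JW]_s - J[JV, W]_s - J[V, JW]_s - [V, W]_s` (all operations in the tangent space
at `x`).  For `s = univ` this is the tree's `nijenhuis`. [folklore] -/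
def nijenhuisWithin (J : (x : W) → (EuclideanSpace ℝ (Fin 4) →L[ℝ] EuclideanSpace ℝ (Fin 4)))
    (V V' : (x : W) → TangentSpace (𝓡∂ 4) x) (s : Set W) (x : W) : TangentSpace (𝓡∂ 4) x :=
  mlieBracketWithin (𝓡∂ 4) (applyJ J V) (applyJ J V') s x -
    JT J x (mlieBracketWithin (𝓡∂ 4) (applyJ J V) V' s x) -
    JT J x (mlieBracketWithin (𝓡∂ 4) V (applyJ J V') s x) -
    mlieBracketWithin (𝓡∂ 4) V V' s x

omit [T2Space W] [IsManifold (𝓡∂ 4) ∞ W] in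
/-- For `s = univ` the Nijenhuis expression within `s` is the Nijenhuis tensor. [folklore] -/
theorem nijenhuisWithin_univ (J : (x : W) → (EuclideanSpace ℝ (Fin 4) →L[ℝ]
      EuclideanSpace ℝ (Fin 4))) (V V' : (x : W) → TangentSpace (𝓡∂ 4) x) (x : W) :
    nijenhuisWithin J V V' univ x = nijenhuis W J V V' x := by
  simp only [nijenhuisWithin, nijenhuis, mlieBracketWithin_univ]
  rfl

/-! #### `J` through the operations of the tangent spaces -/

section TSAlgebra

variable (J : (x : W) → (EuclideanSpace ℝ (Fin 4) →L[ℝ] EuclideanSpace ℝ (Fin 4))) (x : W)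

omit [T2Space W] [IsManifold (𝓡∂ 4) ∞ W] in
/-- `J_x (-b) = -J_x b` in `T_xW`. [folklore] -/
@[simp] theorem JT_neg (b : TangentSpace (𝓡∂ 4) x) : JT J x (-b) = -JT J x b :=
  (J x).map_neg b

omit [T2Space W] [IsManifold (𝓡∂ 4) ∞ W] in
/-- `J_x (a + b) = J_x a + J_x b` in `T_xW`. [folklore] -/
@[simp] theorem JT_add (a b : TangentSpace (𝓡∂ 4) x) : JT J x (a + b) = JT J x a + JT J x b :=
  (J x).map_add a b

omit [T2Space W] [IsManifold (𝓡∂ 4) ∞ W] in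
/-- `J_x (a - b) = J_x a - J_x b` in `T_xW`. [folklore] -/
@[simp] theorem JT_sub (a b : TangentSpace (𝓡∂ 4) x) : JT J x (a - b) = JT J x a - JT J x b :=
  (J x).map_sub a b

omit [T2Space W] [IsManifold (𝓡∂ 4) ∞ W] in
/-- `J_x (r • b) = r • J_x b` in `T_xW`. [folklore] -/
@[simp] theorem JT_smul (r : ℝ) (b : TangentSpace (𝓡∂ 4) x) : JT J x (r • b) = r • JT J x b :=
  (J x).map_smul r b

omit [T2Space W] [IsManifold (𝓡∂ 4) ∞ W] in
/-- `J_x 0 = 0` in `T_xW`. [folklore] -/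
@[simp] theorem JT_zero : JT J x 0 = 0 :=
  (J x).map_zero

omit [T2Space W] [IsManifold (𝓡∂ 4) ∞ W] in
/-- `J_x (∑ bᵢ) = ∑ J_x bᵢ` in `T_xW`. [folklore] -/
theorem JT_sum {ι : Type*} (S : Finset ι) (b : ι → TangentSpace (𝓡∂ 4) x) :
    JT J x (∑ i ∈ S, b i) = ∑ i ∈ S, JT J x (b i) :=
  map_sum (J x) b S

omit [T2Space W] [IsManifold (𝓡∂ 4) ∞ W] in
/-- `J² = -1` in `T_xW`. [folklore] -/
theorem JT_JT (hJ2 : ∀ x v, J x (J x v) = -v) (b : TangentSpace (𝓡∂ 4) x) :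
    JT J x (JT J x b) = -b :=
  hJ2 x b

end TSAlgebra

end JWithin

/-! ### §3 Tensoriality of the Nijenhuis expression within a set; integrability within a set -/

section Tensorial

variable {W : Type*} [TopologicalSpace W] [ChartedSpace (EuclideanHalfSpace 4) W]
  [IsManifold (𝓡∂ 4) ∞ W]
  {J : (x : W) → (EuclideanSpace ℝ (Fin 4) →L[ℝ] EuclideanSpace ℝ (Fin 4))}
  {s : Set W} {y : W}

omit [IsManifold (𝓡∂ 4) ∞ W] in
/-- Locality: the Nijenhuis expression within `s` at `y` only depends on the germs of the
fields at `y`. [folklore] -/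
theorem nijenhuisWithin_congr_of_eventuallyEq {V V₁ V' V₁' : (x : W) → TangentSpace (𝓡∂ 4) x}
    (hV : V₁ =ᶠ[𝓝 y] V) (hV' : V₁' =ᶠ[𝓝 y] V') :
    nijenhuisWithin J V₁ V₁' s y = nijenhuisWithin J V V' s y := by
  have hJV : applyJ J V₁ =ᶠ[𝓝 y] applyJ J V :=
    hV.mono fun z hz => by show JT J z (V₁ z) = JT J z (V z); rw [hz]
  have hJV' : applyJ J V₁' =ᶠ[𝓝 y] applyJ J V' :=
    hV'.mono fun z hz => by show JT J z (V₁' z) = JT J z (V' z); rw [hz]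
  simp only [nijenhuisWithin]
  rw [hJV.mlieBracketWithin_vectorField_eq_nhds hJV', hJV.mlieBracketWithin_vectorField_eq_nhds hV',
    hV.mlieBracketWithin_vectorField_eq_nhds hJV', hV.mlieBracketWithin_vectorField_eq_nhds hV']

omit [IsManifold (𝓡∂ 4) ∞ W] in
/-- Antisymmetry of the Nijenhuis expression within a set. [folklore] -/
theorem nijenhuisWithin_swap (V V' : (x : W) → TangentSpace (𝓡∂ 4) x) :
    nijenhuisWithin J V V' s y = -nijenhuisWithin J V' V s y := by
  simp only [nijenhuisWithin]
  rw [mlieBracketWithin_swap_apply (V := applyJ J V) (W := applyJ J V'),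
    mlieBracketWithin_swap_apply (V := applyJ J V) (W := V'),
    mlieBracketWithin_swap_apply (V := V) (W := applyJ J V'),
    mlieBracketWithin_swap_apply (V := V) (W := V')]
  simp only [JT_neg]
  abel

omit [IsManifold (𝓡∂ 4) ∞ W] in
/-- The Nijenhuis expression within a set vanishes on the zero field. [folklore] -/
theorem nijenhuisWithin_zero_left (V' : (x : W) → TangentSpace (𝓡∂ 4) x) :
    nijenhuisWithin J (0 : (x : W) → TangentSpace (𝓡∂ 4) x) V' s y = 0 := by
  have h0 : applyJ J (0 : (x : W) → TangentSpace (𝓡∂ 4) x) = 0 := by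
    funext z; exact (J z).map_zero
  simp only [nijenhuisWithin]
  rw [h0]
  simp only [mlieBracketWithin_zero_left, Pi.zero_apply, JT_zero, sub_self]

/-- **`C^∞(W)`-linearity of the Nijenhuis expression in the first slot** (within a set): for a
function `f` and fields `V`, `JV` differentiable within `s` at `y`,
`N^s_J(f V, V')(y) = f(y) N^s_J(V, V')(y)` (the terms with `df` cancel in pairs, using
`J² = -1`). [cite: CieliebakEliashberg2012, §1] -/
theorem nijenhuisWithin_smul_left (hJ2 : ∀ x v, J x (J x v) = -v) {f : W → ℝ}
    {V V' : (x : W) → TangentSpace (𝓡∂ 4) x} (hs : UniqueMDiffWithinAt (𝓡∂ 4) s y)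
    (hf : MDifferentiableWithinAt (𝓡∂ 4) 𝓘(ℝ, ℝ) f s y)
    (hV : MDifferentiableWithinAt (𝓡∂ 4) (𝓡∂ 4).tangent (T% V) s y)
    (hJV : MDifferentiableWithinAt (𝓡∂ 4) (𝓡∂ 4).tangent (T% (applyJ J V)) s y) :
    nijenhuisWithin J (f • V) V' s y = f y • nijenhuisWithin J V V' s y := by
  have hfJ : applyJ J (f • V) = f • applyJ J V := by
    funext z; exact (J z).map_smul (f z) (V z)
  simp only [nijenhuisWithin]
  rw [hfJ, mlieBracketWithin_smul_left hf hJV hs, mlieBracketWithin_smul_left hf hJV hs,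
    mlieBracketWithin_smul_left hf hV hs, mlieBracketWithin_smul_left hf hV hs]
  simp only [JT_add, JT_smul, applyJ_apply, JT_JT J _ hJ2, smul_sub, smul_neg]
  abel

/-- `C^∞(W)`-linearity in the second slot. [folklore] -/
theorem nijenhuisWithin_smul_right (hJ2 : ∀ x v, J x (J x v) = -v) {f : W → ℝ}
    {V V' : (x : W) → TangentSpace (𝓡∂ 4) x} (hs : UniqueMDiffWithinAt (𝓡∂ 4) s y)
    (hf : MDifferentiableWithinAt (𝓡∂ 4) 𝓘(ℝ, ℝ) f s y)
    (hV' : MDifferentiableWithinAt (𝓡∂ 4) (𝓡∂ 4).tangent (T% V') s y)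
    (hJV' : MDifferentiableWithinAt (𝓡∂ 4) (𝓡∂ 4).tangent (T% (applyJ J V')) s y) :
    nijenhuisWithin J V (f • V') s y = f y • nijenhuisWithin J V V' s y := by
  rw [nijenhuisWithin_swap, nijenhuisWithin_smul_left hJ2 hs hf hV' hJV', nijenhuisWithin_swap V V',
    smul_neg]

/-- Additivity of the Nijenhuis expression in the first slot (within a set). [folklore] -/
theorem nijenhuisWithin_add_left {V₁ V₂ V' : (x : W) → TangentSpace (𝓡∂ 4) x}
    (hs : UniqueMDiffWithinAt (𝓡∂ 4) s y)
    (hV₁ : MDifferentiableWithinAt (𝓡∂ 4) (𝓡∂ 4).tangent (T% V₁) s y)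
    (hV₂ : MDifferentiableWithinAt (𝓡∂ 4) (𝓡∂ 4).tangent (T% V₂) s y)
    (hJV₁ : MDifferentiableWithinAt (𝓡∂ 4) (𝓡∂ 4).tangent (T% (applyJ J V₁)) s y)
    (hJV₂ : MDifferentiableWithinAt (𝓡∂ 4) (𝓡∂ 4).tangent (T% (applyJ J V₂)) s y) :
    nijenhuisWithin J (V₁ + V₂) V' s y = nijenhuisWithin J V₁ V' s y + nijenhuisWithin J V₂ V' s y := by
  have hJa : applyJ J (V₁ + V₂) = applyJ J V₁ + applyJ J V₂ := by
    funext z; exact (J z).map_add (V₁ z) (V₂ z)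
  simp only [nijenhuisWithin]
  rw [hJa, mlieBracketWithin_add_left hJV₁ hJV₂ hs, mlieBracketWithin_add_left hJV₁ hJV₂ hs,
    mlieBracketWithin_add_left hV₁ hV₂ hs, mlieBracketWithin_add_left hV₁ hV₂ hs]
  simp only [JT_add]
  abel

omit [IsManifold (𝓡∂ 4) ∞ W] in
/-- `J` of a finite sum of fields is the sum of the `J`s. [folklore] -/
theorem applyJ_sum {ι : Type*} (S : Finset ι) (V : ι → (x : W) → TangentSpace (𝓡∂ 4) x) :
    applyJ J (fun z => ∑ i ∈ S, V i z) = fun z => ∑ i ∈ S, applyJ J (V i) z := by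
  funext z
  simp only [applyJ_apply, JT_sum]

/-- Additivity over a finite sum in the first slot (fields `C^∞` within `s` at `y`). [folklore] -/
theorem nijenhuisWithin_sum_left {ι : Type*} (S : Finset ι)
    {V : ι → (x : W) → TangentSpace (𝓡∂ 4) x} {V' : (x : W) → TangentSpace (𝓡∂ 4) x}
    (hs : UniqueMDiffWithinAt (𝓡∂ 4) s y)
    (hV : ∀ i ∈ S, ContMDiffWithinAt (𝓡∂ 4) (𝓡∂ 4).tangent ∞ (T% (V i)) s y)
    (hJV : ∀ i ∈ S, ContMDiffWithinAt (𝓡∂ 4) (𝓡∂ 4).tangent ∞ (T% (applyJ J (V i))) s y) :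
    nijenhuisWithin J (fun z => ∑ i ∈ S, V i z) V' s y = ∑ i ∈ S, nijenhuisWithin J (V i) V' s y := by
  classical
  induction S using Finset.induction_on with
  | empty =>
    simp only [Finset.sum_empty]
    exact nijenhuisWithin_zero_left V'
  | insert a S ha ih =>
    have hV' : ∀ i ∈ S, ContMDiffWithinAt (𝓡∂ 4) (𝓡∂ 4).tangent ∞ (T% (V i)) s y :=
      fun i hi => hV i (Finset.mem_insert_of_mem hi)
    have hJV' : ∀ i ∈ S, ContMDiffWithinAt (𝓡∂ 4) (𝓡∂ 4).tangent ∞ (T% (applyJ J (V i))) s y :=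
      fun i hi => hJV i (Finset.mem_insert_of_mem hi)
    have hsum : ContMDiffWithinAt (𝓡∂ 4) (𝓡∂ 4).tangent ∞
        (T% (fun z => ∑ i ∈ S, V i z)) s y := ContMDiffWithinAt.sum_section hV'
    have hJsum : ContMDiffWithinAt (𝓡∂ 4) (𝓡∂ 4).tangent ∞
        (T% (applyJ J (fun z => ∑ i ∈ S, V i z))) s y := by
      rw [applyJ_sum]
      exact ContMDiffWithinAt.sum_section hJV'
    simp only [Finset.sum_insert ha]
    have hfun : (fun z => V a z + ∑ i ∈ S, V i z) = V a + fun z => ∑ i ∈ S, V i z := rfl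
    rw [hfun, nijenhuisWithin_add_left hs ((hV a (Finset.mem_insert_self a S)).mdifferentiableWithinAt
        (by simp)) (hsum.mdifferentiableWithinAt (by simp))
        ((hJV a (Finset.mem_insert_self a S)).mdifferentiableWithinAt (by simp))
        (hJsum.mdifferentiableWithinAt (by simp)), ih hV' hJV']

/-- For fields differentiable at `y` (not only within `s`), the Nijenhuis expression within a
set of unique differentiability is the Nijenhuis tensor. [folklore] -/
theorem nijenhuisWithin_eq_nijenhuis {V V' : (x : W) → TangentSpace (𝓡∂ 4) x}
    (hs : UniqueMDiffWithinAt (𝓡∂ 4) s y)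
    (hV : MDifferentiableAt (𝓡∂ 4) (𝓡∂ 4).tangent (T% V) y)
    (hV' : MDifferentiableAt (𝓡∂ 4) (𝓡∂ 4).tangent (T% V') y)
    (hJV : MDifferentiableAt (𝓡∂ 4) (𝓡∂ 4).tangent (T% (applyJ J V)) y)
    (hJV' : MDifferentiableAt (𝓡∂ 4) (𝓡∂ 4).tangent (T% (applyJ J V')) y) :
    nijenhuisWithin J V V' s y = nijenhuis W J V V' y := by
  rw [← nijenhuisWithin_univ]
  simp only [nijenhuisWithin]
  rw [mlieBracketWithin_eq_mlieBracket hs hJV hJV', mlieBracketWithin_eq_mlieBracket hs hJV hV',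
    mlieBracketWithin_eq_mlieBracket hs hV hJV', mlieBracketWithin_eq_mlieBracket hs hV hV',
    mlieBracketWithin_univ, mlieBracketWithin_univ, mlieBracketWithin_univ, mlieBracketWithin_univ]


omit [IsManifold (𝓡∂ 4) ∞ W] in
/-- `J` of a multiple of a field. [folklore] -/
theorem applyJ_smul (f : W → ℝ) (V : (x : W) → TangentSpace (𝓡∂ 4) x) :
    applyJ J (f • V) = f • applyJ J V := by
  funext z; exact (J z).map_smul (f z) (V z)

variable [T2Space W]

/-- **Integrability within a set.**  If `J` is a smooth almost complex structure on `W` with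
`J² = -1` whose Nijenhuis tensor vanishes on all smooth vector fields, then the Nijenhuis
expression *within* a set `s` vanishes at every point `y ∈ s` of unique differentiability on
all fields which are merely `C^∞` within `s` at `y`: expand both fields in a smooth frame near
`y` (the constant sections of the trivialization at `y`, globalised by a smooth bump function
supported in the chart domain) with coefficients `C^∞` within `s`, use the `C^∞`-bilinearity of
the Nijenhuis expression (tensoriality), and compare on the frame fields with the Nijenhuis
tensor (`mlieBracketWithin_eq_mlieBracket`). [cite: CieliebakEliashberg2012, §1] -/
theorem nijenhuisWithin_eq_zero (hJ : PreservesSmoothFields J) (hJ2 : ∀ x v, J x (J x v) = -v)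
    (hint : ∀ X Y : (x : W) → TangentSpace (𝓡∂ 4) x, IsSmoothVectorField W X →
      IsSmoothVectorField W Y → ∀ x, nijenhuis W J X Y x = 0)
    (hs : UniqueMDiffWithinAt (𝓡∂ 4) s y)
    {V V' : (x : W) → TangentSpace (𝓡∂ 4) x}
    (hV : ContMDiffWithinAt (𝓡∂ 4) (𝓡∂ 4).tangent ∞ (T% V) s y)
    (hV' : ContMDiffWithinAt (𝓡∂ 4) (𝓡∂ 4).tangent ∞ (T% V') s y) :
    nijenhuisWithin J V V' s y = 0 := by
  set e := trivializationAt (EuclideanSpace ℝ (Fin 4)) (TangentSpace (𝓡∂ 4)) y with he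
  have hb : e.baseSet = (chartAt (EuclideanHalfSpace 4) y).source := rfl
  have hU : (chartAt (EuclideanHalfSpace 4) y).source ∈ 𝓝 y :=
    (chartAt _ y).open_source.mem_nhds (mem_chart_source _ y)
  obtain ⟨χ, hχ, -⟩ := (SmoothBumpFunction.nhds_basis_support (I := 𝓡∂ 4) hU).mem_iff.1 hU
  -- the frame `E i = χ • e⁻¹(eᵢ)` and its properties
  set E : Fin 4 → (z : W) → TangentSpace (𝓡∂ 4) z := fun i =>
    (χ : W → ℝ) • fun z => e.symmL ℝ z (EuclideanSpace.single i (1 : ℝ)) with hEdef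
  have hE : ∀ i, IsSmoothVectorField W (E i) := fun i =>
    ContMDiffOn.smul_section_of_tsupport χ.contMDiff.contMDiffOn (chartAt _ y).open_source hχ
      (contMDiffOn_symmL_trivializationAt y _)
  have hJE : ∀ i, IsSmoothVectorField W (applyJ J (E i)) := fun i => hJ _ (hE i)
  have hEa : ∀ i, MDifferentiableAt (𝓡∂ 4) (𝓡∂ 4).tangent (T% (E i)) y := fun i =>
    ((hE i) y).mdifferentiableAt (by simp)
  have hJEa : ∀ i, MDifferentiableAt (𝓡∂ 4) (𝓡∂ 4).tangent (T% (applyJ J (E i))) y := fun i =>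
    ((hJE i) y).mdifferentiableAt (by simp)
  have hEw : ∀ i, ContMDiffWithinAt (𝓡∂ 4) (𝓡∂ 4).tangent ∞ (T% (E i)) s y := fun i =>
    ((hE i) y).contMDiffWithinAt
  have hJEw : ∀ i, ContMDiffWithinAt (𝓡∂ 4) (𝓡∂ 4).tangent ∞ (T% (applyJ J (E i))) s y :=
    fun i => ((hJE i) y).contMDiffWithinAt
  -- the Nijenhuis expression vanishes on the frame
  have hNE : ∀ i j, nijenhuisWithin J (E i) (E j) s y = 0 := fun i j => by
    rw [nijenhuisWithin_eq_nijenhuis hs (hEa i) (hEa j) (hJEa i) (hJEa j)]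
    exact hint _ _ (hE i) (hE j) y
  -- expansion of a field in the frame near `y`
  have hexp : ∀ (U : (x : W) → TangentSpace (𝓡∂ 4) x) (z : W),
      z ∈ (chartAt (EuclideanHalfSpace 4) y).source → χ z = 1 →
      U z = ∑ i, (e (⟨z, U z⟩ : TangentBundle (𝓡∂ 4) W)).2 i • E i z := by
    intro U z hz hχz
    have hz' : z ∈ e.baseSet := by rw [hb]; exact hz
    have hEz : ∀ i, E i z = e.symmL ℝ z (EuclideanSpace.single i (1 : ℝ)) := fun i => by
      show χ z • e.symmL ℝ z _ = _
      rw [hχz, one_smul]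
    simp only [hEz]
    calc U z = e.symmL ℝ z ((e (⟨z, U z⟩ : TangentBundle (𝓡∂ 4) W)).2) := by
          rw [e.symmL_apply hz', e.symm_apply_apply_mk hz']
      _ = e.symmL ℝ z (∑ i, (e (⟨z, U z⟩ : TangentBundle (𝓡∂ 4) W)).2 i •
            EuclideanSpace.single i (1 : ℝ)) := by rw [sum_apply_smul_single]
      _ = ∑ i, (e (⟨z, U z⟩ : TangentBundle (𝓡∂ 4) W)).2 i •
            e.symmL ℝ z (EuclideanSpace.single i (1 : ℝ)) := by
          rw [map_sum]
          simp only [map_smul]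
  -- coefficients of `V`, `V'` and their smoothness within `s`
  set c : Fin 4 → W → ℝ := fun i z => (e (⟨z, V z⟩ : TangentBundle (𝓡∂ 4) W)).2 i with hcdef
  set c' : Fin 4 → W → ℝ := fun i z => (e (⟨z, V' z⟩ : TangentBundle (𝓡∂ 4) W)).2 i with hc'def
  have hcoef : ∀ {U : (x : W) → TangentSpace (𝓡∂ 4) x},
      ContMDiffWithinAt (𝓡∂ 4) (𝓡∂ 4).tangent ∞ (T% U) s y → ∀ i,
      ContMDiffWithinAt (𝓡∂ 4) 𝓘(ℝ, ℝ) ∞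
        (fun z => (e (⟨z, U z⟩ : TangentBundle (𝓡∂ 4) W)).2 i) s y := by
    intro U hU i
    have h1 : ContMDiffWithinAt (𝓡∂ 4) 𝓘(ℝ, EuclideanSpace ℝ (Fin 4)) ∞
        (fun z => (e (⟨z, U z⟩ : TangentBundle (𝓡∂ 4) W)).2) s y := by
      rw [show (𝓡∂ 4).tangent = (𝓡∂ 4).prod 𝓘(ℝ, EuclideanSpace ℝ (Fin 4)) from rfl,
        contMDiffWithinAt_section] at hU
      exact hU
    exact (EuclideanSpace.proj i).contDiff.comp_contMDiffWithinAt h1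
  have hc : ∀ i, ContMDiffWithinAt (𝓡∂ 4) 𝓘(ℝ, ℝ) ∞ (c i) s y := hcoef hV
  have hc' : ∀ i, ContMDiffWithinAt (𝓡∂ 4) 𝓘(ℝ, ℝ) ∞ (c' i) s y := hcoef hV'
  -- the expanded fields
  set Vs : (x : W) → TangentSpace (𝓡∂ 4) x := fun z => ∑ i ∈ (Finset.univ : Finset (Fin 4)),
    (c i • E i) z with hVs
  set Vs' : (x : W) → TangentSpace (𝓡∂ 4) x := fun z => ∑ i ∈ (Finset.univ : Finset (Fin 4)),
    (c' i • E i) z with hVs'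
  have hVeq : V =ᶠ[𝓝 y] Vs := by
    filter_upwards [hU, χ.eventuallyEq_one] with z hz hχz
    exact hexp V z hz hχz
  have hV'eq : V' =ᶠ[𝓝 y] Vs' := by
    filter_upwards [hU, χ.eventuallyEq_one] with z hz hχz
    exact hexp V' z hz hχz
  rw [nijenhuisWithin_congr_of_eventuallyEq (J := J) (s := s) hVeq.symm hV'eq.symm |>.symm]
  -- smoothness of the summands
  have hsm : ∀ (g : W → ℝ), ContMDiffWithinAt (𝓡∂ 4) 𝓘(ℝ, ℝ) ∞ g s y → ∀ i,
      ContMDiffWithinAt (𝓡∂ 4) (𝓡∂ 4).tangent ∞ (T% (g • E i)) s y :=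
    fun g hg i => hg.smul_section (hEw i)
  have hsmJ : ∀ (g : W → ℝ), ContMDiffWithinAt (𝓡∂ 4) 𝓘(ℝ, ℝ) ∞ g s y → ∀ i,
      ContMDiffWithinAt (𝓡∂ 4) (𝓡∂ 4).tangent ∞ (T% (applyJ J (g • E i))) s y :=
    fun g hg i => by rw [applyJ_smul]; exact hg.smul_section (hJEw i)
  -- expand the first slot, then the second
  rw [nijenhuisWithin_sum_left _ hs (fun i _ => hsm _ (hc i) i) (fun i _ => hsmJ _ (hc i) i)]
  refine Finset.sum_eq_zero fun i _ => ?_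
  rw [nijenhuisWithin_smul_left hJ2 hs ((hc i).mdifferentiableWithinAt (by simp))
    ((hEw i).mdifferentiableWithinAt (by simp)) ((hJEw i).mdifferentiableWithinAt (by simp)),
    nijenhuisWithin_swap,
    nijenhuisWithin_sum_left _ hs (fun j _ => hsm _ (hc' j) j) (fun j _ => hsmJ _ (hc' j) j)]
  have hin : ∑ j ∈ (Finset.univ : Finset (Fin 4)), nijenhuisWithin J (c' j • E j) (E i) s y = 0 :=
    Finset.sum_eq_zero fun j _ => by
      rw [nijenhuisWithin_smul_left hJ2 hs ((hc' j).mdifferentiableWithinAt (by simp))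
        ((hEw j).mdifferentiableWithinAt (by simp)) ((hJEw j).mdifferentiableWithinAt (by simp)),
        hNE j i, smul_zero]
  rw [hin, neg_zero, smul_zero]

end Tensorial

/-! ### §4 The almost complex structure of a regular domain -/

namespace RegularDomain

variable {W : Type*} [TopologicalSpace W] [ChartedSpace (EuclideanHalfSpace 4) W]
  {t : Set W} (Φ : HalfSliceAtlas (𝓡∂ 4) t)
  [cs : ChartedSpace (EuclideanHalfSpace 4) t] (hcs : cs = Φ.chartedSpace)
  (J : (x : W) → (EuclideanSpace ℝ (Fin 4) →L[ℝ] EuclideanSpace ℝ (Fin 4)))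

include hcs

/-- **The almost complex structure of the domain**, read in its own charts:
`J^t_p = (Dι_p)⁻¹ ∘ J_p ∘ Dι_p`. [folklore] -/
def domJ (p : t) : EuclideanSpace ℝ (Fin 4) →L[ℝ] EuclideanSpace ℝ (Fin 4) :=
  ((valDeriv Φ hcs p).symm : EuclideanSpace ℝ (Fin 4) →L[ℝ] EuclideanSpace ℝ (Fin 4)).comp
    ((J p.1).comp (valDeriv Φ hcs p : EuclideanSpace ℝ (Fin 4) →L[ℝ] EuclideanSpace ℝ (Fin 4)))

/-- Unfolding `domJ`. [folklore] -/
theorem domJ_apply (p : t) (v : EuclideanSpace ℝ (Fin 4)) :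
    domJ Φ hcs J p v = (valDeriv Φ hcs p).symm (J p.1 (valDeriv Φ hcs p v)) := rfl

/-- Read ambiently, `J^t` is `J`: `Dι_p (J^t_p v) = J_p (Dι_p v)`. [folklore] -/
@[simp] theorem valDeriv_domJ (p : t) (v : EuclideanSpace ℝ (Fin 4)) :
    valDeriv Φ hcs p (domJ Φ hcs J p v) = J p.1 (valDeriv Φ hcs p v) := by
  rw [domJ_apply, ContinuousLinearEquiv.apply_symm_apply]

/-- `J^t` on a pulled-back vector: `J^t_p ((Dι_p)⁻¹ u) = (Dι_p)⁻¹ (J_p u)`. [folklore] -/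
theorem domJ_symm_apply (p : t) (u : EuclideanSpace ℝ (Fin 4)) :
    domJ Φ hcs J p ((valDeriv Φ hcs p).symm u) = (valDeriv Φ hcs p).symm (J p.1 u) := by
  rw [domJ_apply, ContinuousLinearEquiv.apply_symm_apply]

/-- `(J^t)² = -1` if `J² = -1`. [folklore] -/
theorem domJ_sq (hJ2 : ∀ x v, J x (J x v) = -v) (p : t) (v : EuclideanSpace ℝ (Fin 4)) :
    domJ Φ hcs J p (domJ Φ hcs J p v) = -v := by
  apply (valDeriv Φ hcs p).injective
  rw [valDeriv_domJ, valDeriv_domJ, hJ2, map_neg]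

/-- The ambient representative of `J^t X` is `J` applied to that of `X`. [folklore] -/
theorem extVF_domJ (X : (q : t) → TangentSpace (𝓡∂ 4) q) :
    extVF Φ hcs (fun q => domJ Φ hcs J q (X q)) = applyJ J (extVF Φ hcs X) := by
  funext y
  by_cases hy : y ∈ t
  · rw [applyJ_apply, JT_eq, extVF_of_mem Φ hcs _ hy, extVF_of_mem Φ hcs _ hy, valDeriv_domJ]
  · rw [applyJ_apply, JT_eq, extVF_of_not_mem Φ hcs _ hy, extVF_of_not_mem Φ hcs _ hy]
    exact ((J y).map_zero).symm

variable [T2Space W] [IsManifold (𝓡∂ 4) ∞ W] [IsManifold (𝓡∂ 4) ∞ t]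

/-- **`J^t` preserves smooth vector fields** when `J` does: `J^t X` is the pull-back along the
inclusion of `J X̃`, and `J X̃` is smooth within `t` (`ContMDiffWithinAt.J_family`). [folklore] -/
theorem isSmoothVectorField_domJ (hJ : PreservesSmoothFields J)
    {X : (q : t) → TangentSpace (𝓡∂ 4) q} (hX : IsSmoothVectorField t X) :
    IsSmoothVectorField t fun q => domJ Φ hcs J q (X q) := by
  intro p
  have h1 := contMDiffWithinAt_extVF Φ hcs (hX p)
  have h2 : ContMDiffWithinAt (𝓡∂ 4) (𝓡∂ 4).tangent ∞ (T% (applyJ J (extVF Φ hcs X))) t p.1 :=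
    ContMDiffWithinAt.J_family hJ (x := id) (v := extVF Φ hcs X) h1
  have h3 := contMDiffAt_mpullback_val Φ hcs h2
  refine h3.congr_of_eventuallyEq (Eventually.of_forall fun q => ?_)
  show (TotalSpace.mk' _ q (domJ Φ hcs J q (X q)) : TangentBundle (𝓡∂ 4) t) =
    TotalSpace.mk' _ q (mpullback (𝓡∂ 4) (𝓡∂ 4) Subtype.val (applyJ J (extVF Φ hcs X)) q)
  rw [mpullback_val Φ hcs]
  show _ = (TotalSpace.mk' _ q ((valDeriv Φ hcs q).symm (J q.1 (extVF Φ hcs X q.1))) :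
    TangentBundle (𝓡∂ 4) t)
  rw [extVF_val, domJ_apply]

/-- **The Nijenhuis tensor of `J^t` is the pull-back of the Nijenhuis expression of `J` within
`t`** on the ambient representatives: `N_{J^t}(X, Y)(p) = (Dι_p)⁻¹ N^t_J(X̃, Ỹ)(p)`. [folklore] -/
theorem nijenhuis_domJ (hJ : PreservesSmoothFields J)
    {X Y : (q : t) → TangentSpace (𝓡∂ 4) q}
    (hX : IsSmoothVectorField t X) (hY : IsSmoothVectorField t Y) (p : t) :
    nijenhuis t (domJ Φ hcs J) X Y p = (valDeriv Φ hcs p).symm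
      (nijenhuisWithin J (extVF Φ hcs X) (extVF Φ hcs Y) t p.1) := by
  have hJX := isSmoothVectorField_domJ Φ hcs J hJ hX
  have hJY := isSmoothVectorField_domJ Φ hcs J hJ hY
  simp only [nijenhuis, nijenhuisWithin]
  rw [mlieBracket_eq_valDeriv_symm_mlieBracketWithin Φ hcs hJX hJY,
    mlieBracket_eq_valDeriv_symm_mlieBracketWithin Φ hcs hJX hY,
    mlieBracket_eq_valDeriv_symm_mlieBracketWithin Φ hcs hX hJY,
    mlieBracket_eq_valDeriv_symm_mlieBracketWithin Φ hcs hX hY,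
    extVF_domJ, extVF_domJ, domJ_symm_apply, domJ_symm_apply, ← map_sub, ← map_sub, ← map_sub]
  rfl

omit [T2Space W] in
/-- **A regular domain is a set of unique differentiability at each of its points** (it is
the image of the manifold-with-boundary `t` under the inclusion, whose differential is onto;
Mathlib's `UniqueMDiffWithinAt.image_denseRange`). [folklore] -/
theorem uniqueMDiffWithinAt (p : t) : UniqueMDiffWithinAt (𝓡∂ 4) t p.1 := by
  have h := (uniqueMDiffWithinAt_univ (𝓡∂ 4) (x := p)).image_denseRange
    (((contMDiff_val Φ hcs p).mdifferentiableAt (by simp)).hasMFDerivAt.hasMFDerivWithinAt)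
    (isInvertible_mfderiv_val Φ hcs p).surjective.denseRange
  rwa [image_univ, Subtype.range_coe] at h

/-- **`J^t` is integrable when `J` is**: the Nijenhuis tensor of `J^t` on smooth vector fields
of the domain is `(Dι)⁻¹` of the Nijenhuis expression of `J` within `t` on the ambient
representatives (`nijenhuis_domJ`), which vanishes by integrability within a set
(`nijenhuisWithin_eq_zero`). [cite: CieliebakEliashberg2012, §1] -/
theorem nijenhuis_domJ_eq_zero (hJ : PreservesSmoothFields J) (hJ2 : ∀ x v, J x (J x v) = -v)
    (hint : ∀ X Y : (x : W) → TangentSpace (𝓡∂ 4) x, IsSmoothVectorField W X →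
      IsSmoothVectorField W Y → ∀ x, nijenhuis W J X Y x = 0)
    {X Y : (q : t) → TangentSpace (𝓡∂ 4) q}
    (hX : IsSmoothVectorField t X) (hY : IsSmoothVectorField t Y) (p : t) :
    nijenhuis t (domJ Φ hcs J) X Y p = 0 := by
  rw [nijenhuis_domJ Φ hcs J hJ hX hY p,
    nijenhuisWithin_eq_zero hJ hJ2 hint (uniqueMDiffWithinAt Φ hcs p)
      (contMDiffWithinAt_extVF Φ hcs (hX p)) (contMDiffWithinAt_extVF Φ hcs (hY p))]
  exact (valDeriv Φ hcs p).symm.map_zero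

end RegularDomain

end Literature.Geometry.Symplectic

end
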